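import Mathlib
import Summits.QuantumFields.YangMills.Theorems.CoarseStiffnessTailCappedCoarseStiffnessLBoundedDepthCompactCoupling
import Summits.QuantumFields.YangMills.Theorems.CoarseStiffnessTailCappedCoarseStiffnessLEdgeBulkFactorisation
import Summits.QuantumFields.YangMills.Theorems.CoarseStiffnessTailCappedCoarseStiffnessLBareUniformCount

/-!
# Route `CoarseStiffnessTail` — THE REGISTERED STUBS REDUCE TO THEIR DEEP TAILS: skeleton v6's composition
# (lead's certificate, seat `ym-line-cst-p1` g14; helper on 25301 `CappedCoarseStiffnessL`)

THE THEOREMS (the crux's objects verbatim; "v5" = the registered skeleton `Cruxes/CappedCoarseStiffnessL/Lines/birth.lean` of g9).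
* ★★ `uniformLargeFieldCountPos_of_deep`: v5's EDGE stub `stub_uniformLargeFieldCountPos` (heights `1 ≤ j ≤ K`, constants uniform in
  `F, γ ≤ γ₁, K, j`) FOLLOWS from its DEEP TAIL — the same bound at the heights `j > j₀` only, for SOME `j₀` (chosen after `L, b₀, p₀`):
  the bounded heights `j ≤ j₀` are g13's `CoarseStiffnessTailEdgeBoundedDepth.uniformLargeFieldCount_boundedDepth` (γ-uniform), and the
  constants merge by `min`/`max` (`integral_exp_count_mono`).
* ★★ `subThresholdStiffness_of_tail`: v5's BULK stub `stub_subThresholdStiffness` FOLLOWS from its DEEP-OR-SUPERWEAK TAIL — the same bound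
  on the instances `j > j₀ ∨ γ < γ_lo` only, for SOME `j₀` and `γ_lo > 0`: the instances `j ≤ j₀ ∧ γ_lo ≤ γ` are this seat's
  `CoarseStiffnessTailBoundedDepthCompactCoupling.bulk_boundedDepth_compactCoupling`, merged by `integral_exp_bulk_mono`.
* ★★★ `cappedCoarseStiffnessL_of_deepStubs`: EDGE deep tail ∧ BULK deep-or-superweak tail ⇒ `CappedCoarseStiffnessL` (stmt-QuantumFields-25301),
  through g9's `uniformLargeFieldCount_of_pos` and g8's `cappedCoarseStiffnessL_of_subThreshold_and_uniformCount` — the composition of the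
  reshaped skeleton v6 (`Lines/birth.lean`), whose two stubs are exactly these tails.

WHAT IT SAYS (line card `Cruxes/CappedCoarseStiffnessL/Lines/birth.md` §g14).  After g9 (EDGE at `j = 0`), g13 (EDGE at every bounded depth),
and this generation's `…LBareCompactCoupling` / `…LBoundedDepthCompactCoupling` (crux and BULK at every bounded depth on every compact coupling
range), NO bounded-depth instance of either registered stub at a fixed coupling is part of the obligation any more: the stubs ARE their tails.
EDGE's tail is purely DEEP (`j → ∞` with `K`; γ-uniformity at bounded depth is g13's theorem); BULK's tail is deep OR superweak (`γ → 0` at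
bounded depth = the fixed-lattice Laplace exponent, g2/g12 — present only because the crux types `∃ C₀ ∀ γ ≤ γ₁`).  The deep tails are the
renormalisation-group content of [Balaban1985UV3] ((71) for EDGE, (5)/(70) for BULK), unchanged and not claimed.

HONEST SCOPE.  Bookkeeping (case split on the depth and the coupling, monotonicity in the tilt strength); nothing of Bałaban's estimates is
asserted; the crux 25301, both stubs (now: their tails), `HistoryTailL` 19936 and every rung above stay OPEN; `YM3TorusSU2` (R3, RECORD rung,
not Clay) is NOT proved; the Yang–Mills mass gap is NOT touched.

References: T. Bałaban, CMP **102** (1985) 255–275 [Balaban1985UV3] ((5) p.256, (70)–(71) p.273).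
-/

noncomputable section

namespace Summit.QuantumFields.YangMills.Theorems.CoarseStiffnessTailDeepTailReduction

open MeasureTheory Finset
open Literature.MathematicalPhysics.QuantumFieldTheory
open Literature.MathematicalPhysics.QuantumFieldTheory.Balaban1983to89
open Literature.MathematicalPhysics.QuantumFieldTheory.Balaban1983to89.BlockAveraging (blockAvg)
open Literature.MathematicalPhysics.QuantumFieldTheory.Balaban1983to89.T3ContinuumYM3Torus
open Literature.MathematicalPhysics.QuantumFieldTheory.Balaban1983to89.T3UnitScaleTilt
open Literature.MathematicalPhysics.QuantumFieldTheory.Balaban1983to89.T3UnitLawDensityEML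
open Literature.MathematicalPhysics.QuantumFieldTheory.Balaban1983to89.T4PairDerivBridge (dist1_le_two_specialUnitaryGroup)
open Summit.QuantumFields.YangMills.Theorems.CoarseStiffnessTailPressureConvexity (integrable_of_bounded)
open Summit.QuantumFields.YangMills.Theorems.LargeFieldMassRefinementTailSubGaussianRung (measurable_dist1_iter)
open Summit.QuantumFields.YangMills.Theorems.CoarseStiffnessTailEdgeBoundedDepth (uniformLargeFieldCount_boundedDepth)
open Summit.QuantumFields.YangMills.Theorems.CoarseStiffnessTailBareUniformCount (integral_exp_count_mono uniformLargeFieldCount_of_pos)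
open Summit.QuantumFields.YangMills.Theorems.CoarseStiffnessTailEdgeBulkFactorisation (cappedCoarseStiffnessL_of_subThreshold_and_uniformCount)
open Summit.QuantumFields.YangMills.Theorems.CoarseStiffnessTailBoundedDepthCompactCoupling (bulk_boundedDepth_compactCoupling)

/-! ## §1 Monotonicity of the sub-threshold moment in the tilt strength -/

section Mono

variable (F : T3Family)

/-- `0 ≤ c ≤ c'` ⇒ `∫exp(c·Y) ≤ ∫exp(c'·Y)` for the (non-negative, bounded) sub-threshold sum `Y = Σ_a |Ū^j(∂a) − 1|²·1[|Ū^j(∂a) − 1| < θ]`. [folklore] -/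
theorem integral_exp_bulk_mono {γ : ℝ} (hγ : 0 < γ) (K j : ℕ) (θ : ℝ) {c c' : ℝ} (hc : 0 ≤ c) (hcc' : c ≤ c') :
    ∫ U, Real.exp (c * ∑ a : Plaq (F.P K) j, (if GaugeGroup.dist1 (GaugeField.plaqHol
        (Averaging.iter (fun i => blockAvg (P := F.P K) (j := i) ℰp) j U) a) < θ then GaugeGroup.dist1 (GaugeField.plaqHol
        (Averaging.iter (fun i => blockAvg (P := F.P K) (j := i) ℰp) j U) a) ^ 2 else 0)) ∂(gibbsK F ℰp γ K) ≤
      ∫ U, Real.exp (c' * ∑ a : Plaq (F.P K) j, (if GaugeGroup.dist1 (GaugeField.plaqHol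
        (Averaging.iter (fun i => blockAvg (P := F.P K) (j := i) ℰp) j U) a) < θ then GaugeGroup.dist1 (GaugeField.plaqHol
        (Averaging.iter (fun i => blockAvg (P := F.P K) (j := i) ℰp) j U) a) ^ 2 else 0)) ∂(gibbsK F ℰp γ K) := by
  haveI := isProbabilityMeasure_gibbsK F ℰp hγ.le K
  have hS : ∀ U : GaugeField (F.P K) 0 (Matrix.specialUnitaryGroup (Fin 2) ℂ),
      0 ≤ ∑ a : Plaq (F.P K) j, (if GaugeGroup.dist1 (GaugeField.plaqHol
        (Averaging.iter (fun i => blockAvg (P := F.P K) (j := i) ℰp) j U) a) < θ then GaugeGroup.dist1 (GaugeField.plaqHol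
        (Averaging.iter (fun i => blockAvg (P := F.P K) (j := i) ℰp) j U) a) ^ 2 else 0) ∧
      ∑ a : Plaq (F.P K) j, (if GaugeGroup.dist1 (GaugeField.plaqHol
        (Averaging.iter (fun i => blockAvg (P := F.P K) (j := i) ℰp) j U) a) < θ then GaugeGroup.dist1 (GaugeField.plaqHol
        (Averaging.iter (fun i => blockAvg (P := F.P K) (j := i) ℰp) j U) a) ^ 2 else 0) ≤ 4 * (Fintype.card (Plaq (F.P K) j) : ℝ) :=
    fun U => by
    have hterm : ∀ a : Plaq (F.P K) j,
        0 ≤ (if GaugeGroup.dist1 (GaugeField.plaqHol (Averaging.iter (fun i => blockAvg (P := F.P K) (j := i) ℰp) j U) a) < θ then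
          GaugeGroup.dist1 (GaugeField.plaqHol (Averaging.iter (fun i => blockAvg (P := F.P K) (j := i) ℰp) j U) a) ^ 2 else 0) ∧
        (if GaugeGroup.dist1 (GaugeField.plaqHol (Averaging.iter (fun i => blockAvg (P := F.P K) (j := i) ℰp) j U) a) < θ then
          GaugeGroup.dist1 (GaugeField.plaqHol (Averaging.iter (fun i => blockAvg (P := F.P K) (j := i) ℰp) j U) a) ^ 2 else 0) ≤ 4 :=
      fun a => by
      have h2 := dist1_le_two_specialUnitaryGroup (GaugeField.plaqHol (Averaging.iter (fun i => blockAvg (P := F.P K) (j := i) ℰp) j U) a)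
      have h0 := GaugeGroup.dist1_nonneg (GaugeField.plaqHol (Averaging.iter (fun i => blockAvg (P := F.P K) (j := i) ℰp) j U) a)
      split_ifs
      · exact ⟨sq_nonneg _, by nlinarith⟩
      · exact ⟨le_rfl, by norm_num⟩
    refine ⟨sum_nonneg fun a _ => (hterm a).1, ?_⟩
    calc _ ≤ ∑ _a : Plaq (F.P K) j, (4 : ℝ) := sum_le_sum fun a _ => (hterm a).2
      _ = 4 * (Fintype.card (Plaq (F.P K) j) : ℝ) := by rw [sum_const, card_univ, nsmul_eq_mul, mul_comm]
  refine integral_mono_of_nonneg (ae_of_all _ fun U => (Real.exp_pos _).le) ?_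
    (ae_of_all _ fun U => Real.exp_le_exp.mpr (mul_le_mul_of_nonneg_right hcc' (hS U).1))
  refine integrable_of_bounded (Measurable.const_mul (Finset.measurable_sum _ fun a _ =>
      Measurable.ite (measurableSet_lt (measurable_dist1_iter F K j a) measurable_const)
        ((measurable_dist1_iter F K j a).pow_const 2) measurable_const) _).exp
    (M := Real.exp (c' * (4 * (Fintype.card (Plaq (F.P K) j) : ℝ)))) fun U => ?_
  rw [abs_of_pos (Real.exp_pos _)]
  exact Real.exp_le_exp.mpr (mul_le_mul_of_nonneg_left (hS U).2 (hc.trans hcc'))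

end Mono

/-! ## §2 The EDGE stub from its deep tail -/

section Edge

/-- **★★ v5's EDGE STUB FROM ITS DEEP TAIL** (g13's bounded-depth theorem supplies every height `j ≤ j₀`, γ-uniformly). [cite: Balaban1985UV3, (71) p.273] -/
theorem uniformLargeFieldCountPos_of_deep
    (h : ∀ (L : ℕ) (b₀ p₀ : ℝ), 0 < b₀ → 2 < p₀ → ∃ (j₀ : ℕ) (c₀ C₀ γ₁ : ℝ), 0 < c₀ ∧ 0 < γ₁ ∧ γ₁ ≤ 1 ∧
      ∀ (F : T3Family) (γ : ℝ), F.L = L → 0 < γ → γ ≤ γ₁ → ∀ (K j : ℕ), j₀ < j → j ≤ K →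
        ∫ U, Real.exp (c₀ * B10.pFun b₀ p₀ (Real.sqrt (γ * ((F.L : ℝ)⁻¹) ^ (K - j))) ^ 2 *
            ∑ a : Plaq (F.P K) j, (if T3UnitScaleTilt.θBal F.L γ b₀ p₀ (K - j) ≤ GaugeGroup.dist1 (GaugeField.plaqHol
              (Averaging.iter (fun i => BlockAveraging.blockAvg (P := F.P K) (j := i) T3UnitLawDensityEML.ℰp) j U) a)
              then (1 : ℝ) else 0)) ∂(T3UnitScaleTilt.gibbsK F T3UnitLawDensityEML.ℰp γ K) ≤
          Real.exp (C₀ * (Fintype.card (Plaq (F.P K) j) : ℝ))) :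
    ∀ (L : ℕ) (b₀ p₀ : ℝ), 0 < b₀ → 2 < p₀ → ∃ (c₀ C₀ γ₁ : ℝ), 0 < c₀ ∧ 0 < γ₁ ∧ γ₁ ≤ 1 ∧
      ∀ (F : T3Family) (γ : ℝ), F.L = L → 0 < γ → γ ≤ γ₁ → ∀ (K j : ℕ), 1 ≤ j → j ≤ K →
        ∫ U, Real.exp (c₀ * B10.pFun b₀ p₀ (Real.sqrt (γ * ((F.L : ℝ)⁻¹) ^ (K - j))) ^ 2 *
            ∑ a : Plaq (F.P K) j, (if T3UnitScaleTilt.θBal F.L γ b₀ p₀ (K - j) ≤ GaugeGroup.dist1 (GaugeField.plaqHol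
              (Averaging.iter (fun i => BlockAveraging.blockAvg (P := F.P K) (j := i) T3UnitLawDensityEML.ℰp) j U) a)
              then (1 : ℝ) else 0)) ∂(T3UnitScaleTilt.gibbsK F T3UnitLawDensityEML.ℰp γ K) ≤
          Real.exp (C₀ * (Fintype.card (Plaq (F.P K) j) : ℝ)) := by
  intro L b₀ p₀ hb₀ hp₀
  obtain ⟨j₀, c₁, C₁, γ₁, hc₁, hγ₁, hγ₁1, hD⟩ := h L b₀ p₀ hb₀ hp₀
  obtain ⟨c₂, C₂, γ₂, hc₂, hγ₂, hγ₂1, hB⟩ := uniformLargeFieldCount_boundedDepth L b₀ p₀ hb₀ hp₀ j₀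
  refine ⟨min c₁ c₂, max C₁ C₂, min γ₁ γ₂, lt_min hc₁ hc₂, lt_min hγ₁ hγ₂, (min_le_left _ _).trans hγ₁1,
    fun F γ hFL hγ hγle K j _ hjK => ?_⟩
  have hPj : (0 : ℝ) ≤ (Fintype.card (Plaq (F.P K) j) : ℝ) := Nat.cast_nonneg _
  by_cases hj : j ≤ j₀
  · exact ((integral_exp_count_mono F hγ.le b₀ p₀ K j (min_le_right c₁ c₂) hc₂.le).trans
      (hB F γ hFL hγ (hγle.trans (min_le_right _ _)) K j hjK hj)).trans
      (Real.exp_le_exp.mpr (mul_le_mul_of_nonneg_right (le_max_right _ _) hPj))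
  · exact ((integral_exp_count_mono F hγ.le b₀ p₀ K j (min_le_left c₁ c₂) hc₁.le).trans
      (hD F γ hFL hγ (hγle.trans (min_le_left _ _)) K j (not_le.1 hj) hjK)).trans
      (Real.exp_le_exp.mpr (mul_le_mul_of_nonneg_right (le_max_left _ _) hPj))

end Edge

/-! ## §3 The BULK stub from its deep-or-superweak tail -/

section Bulk

/-- **★★ v5's BULK STUB FROM ITS DEEP-OR-SUPERWEAK TAIL** (this seat's bounded-depth/compact-coupling theorem supplies every instance
`j ≤ j₀ ∧ γ_lo ≤ γ`). [cite: Balaban1985UV3, (5) p.256 and (70) p.273] -/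
theorem subThresholdStiffness_of_tail
    (h : ∀ (L : ℕ) (b₀ p₀ : ℝ), 0 < b₀ → 2 < p₀ → ∃ (j₀ : ℕ) (γlo c₀ C₀ γ₁ : ℝ), 0 < γlo ∧ 0 < c₀ ∧ 0 < γ₁ ∧ γ₁ ≤ 1 ∧
      ∀ (F : T3Family) (γ : ℝ), F.L = L → 0 < γ → γ ≤ γ₁ → ∀ (K j : ℕ), j ≤ K → (j₀ < j ∨ γ < γlo) →
        ∫ U, Real.exp (c₀ * (γ * ((F.L : ℝ)⁻¹) ^ (K - j))⁻¹ *
            ∑ a : Plaq (F.P K) j, (if GaugeGroup.dist1 (GaugeField.plaqHol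
              (Averaging.iter (fun i => BlockAveraging.blockAvg (P := F.P K) (j := i) T3UnitLawDensityEML.ℰp) j U) a) <
                T3UnitScaleTilt.θBal F.L γ b₀ p₀ (K - j) then
              GaugeGroup.dist1 (GaugeField.plaqHol
                (Averaging.iter (fun i => BlockAveraging.blockAvg (P := F.P K) (j := i) T3UnitLawDensityEML.ℰp) j U) a) ^ 2 else 0))
            ∂(T3UnitScaleTilt.gibbsK F T3UnitLawDensityEML.ℰp γ K) ≤
          Real.exp (C₀ * (Fintype.card (Plaq (F.P K) j) : ℝ))) :
    ∀ (L : ℕ) (b₀ p₀ : ℝ), 0 < b₀ → 2 < p₀ → ∃ (c₀ C₀ γ₁ : ℝ), 0 < c₀ ∧ 0 < γ₁ ∧ γ₁ ≤ 1 ∧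
      ∀ (F : T3Family) (γ : ℝ), F.L = L → 0 < γ → γ ≤ γ₁ → ∀ (K j : ℕ), j ≤ K →
        ∫ U, Real.exp (c₀ * (γ * ((F.L : ℝ)⁻¹) ^ (K - j))⁻¹ *
            ∑ a : Plaq (F.P K) j, (if GaugeGroup.dist1 (GaugeField.plaqHol
              (Averaging.iter (fun i => BlockAveraging.blockAvg (P := F.P K) (j := i) T3UnitLawDensityEML.ℰp) j U) a) <
                T3UnitScaleTilt.θBal F.L γ b₀ p₀ (K - j) then
              GaugeGroup.dist1 (GaugeField.plaqHol
                (Averaging.iter (fun i => BlockAveraging.blockAvg (P := F.P K) (j := i) T3UnitLawDensityEML.ℰp) j U) a) ^ 2 else 0))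
            ∂(T3UnitScaleTilt.gibbsK F T3UnitLawDensityEML.ℰp γ K) ≤
          Real.exp (C₀ * (Fintype.card (Plaq (F.P K) j) : ℝ)) := by
  intro L b₀ p₀ hb₀ hp₀
  obtain ⟨j₀, γlo, c₁, C₁, γ₁, hγlo, hc₁, hγ₁, hγ₁1, hT⟩ := h L b₀ p₀ hb₀ hp₀
  obtain ⟨c₂, C₂, hc₂, hB⟩ := bulk_boundedDepth_compactCoupling L j₀ γlo hγlo
  refine ⟨min c₁ c₂, max C₁ C₂, γ₁, lt_min hc₁ hc₂, hγ₁, hγ₁1, fun F γ hFL hγ hγle K j hjK => ?_⟩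
  have hmin0 : 0 ≤ min c₁ c₂ := (lt_min hc₁ hc₂).le
  have hβ0 : 0 ≤ (γ * ((F.L : ℝ)⁻¹) ^ (K - j))⁻¹ := inv_nonneg.2 (mul_nonneg hγ.le (pow_nonneg (inv_nonneg.2 (Nat.cast_nonneg _)) _))
  have hPj : (0 : ℝ) ≤ (Fintype.card (Plaq (F.P K) j) : ℝ) := Nat.cast_nonneg _
  have hmono : ∀ {c : ℝ}, min c₁ c₂ ≤ c →
      ∫ U, Real.exp (min c₁ c₂ * (γ * ((F.L : ℝ)⁻¹) ^ (K - j))⁻¹ *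
          ∑ a : Plaq (F.P K) j, (if GaugeGroup.dist1 (GaugeField.plaqHol
            (Averaging.iter (fun i => BlockAveraging.blockAvg (P := F.P K) (j := i) T3UnitLawDensityEML.ℰp) j U) a) <
              T3UnitScaleTilt.θBal F.L γ b₀ p₀ (K - j) then
            GaugeGroup.dist1 (GaugeField.plaqHol
              (Averaging.iter (fun i => BlockAveraging.blockAvg (P := F.P K) (j := i) T3UnitLawDensityEML.ℰp) j U) a) ^ 2 else 0))
          ∂(T3UnitScaleTilt.gibbsK F T3UnitLawDensityEML.ℰp γ K) ≤
        ∫ U, Real.exp (c * (γ * ((F.L : ℝ)⁻¹) ^ (K - j))⁻¹ *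
          ∑ a : Plaq (F.P K) j, (if GaugeGroup.dist1 (GaugeField.plaqHol
            (Averaging.iter (fun i => BlockAveraging.blockAvg (P := F.P K) (j := i) T3UnitLawDensityEML.ℰp) j U) a) <
              T3UnitScaleTilt.θBal F.L γ b₀ p₀ (K - j) then
            GaugeGroup.dist1 (GaugeField.plaqHol
              (Averaging.iter (fun i => BlockAveraging.blockAvg (P := F.P K) (j := i) T3UnitLawDensityEML.ℰp) j U) a) ^ 2 else 0))
          ∂(T3UnitScaleTilt.gibbsK F T3UnitLawDensityEML.ℰp γ K) :=
    fun {c} hc => by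
    have h1 := integral_exp_bulk_mono F hγ K j (T3UnitScaleTilt.θBal F.L γ b₀ p₀ (K - j)) (mul_nonneg hmin0 hβ0)
      (mul_le_mul_of_nonneg_right hc hβ0)
    simpa only [mul_assoc] using h1
  by_cases htail : j₀ < j ∨ γ < γlo
  · exact ((hmono (min_le_left _ _)).trans (hT F γ hFL hγ hγle K j hjK htail)).trans
      (Real.exp_le_exp.mpr (mul_le_mul_of_nonneg_right (le_max_left _ _) hPj))
  · push Not at htail
    exact ((hmono (min_le_right _ _)).trans (hB F hFL γ b₀ p₀ htail.2 (hγle.trans hγ₁1) K j htail.1 hjK)).trans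
      (Real.exp_le_exp.mpr (mul_le_mul_of_nonneg_right (le_max_right _ _) hPj))

end Bulk

/-! ## §4 Skeleton v6's composition: the crux from the two tails -/

section Compose

/-- **★★★ THE CRUX FROM THE DEEP TAILS OF ITS TWO STUBS**: EDGE deep tail (`j > j₀`) and BULK deep-or-superweak tail (`j > j₀ ∨ γ < γ_lo`) ⇒
`CappedCoarseStiffnessL` (stmt-QuantumFields-25301), through §2, §3, g9's `uniformLargeFieldCount_of_pos` (height `0`) and g8's exact factorisation
`cappedCoarseStiffnessL_of_subThreshold_and_uniformCount`. [cite: Balaban1985UV3, (5) p.256 and (71) p.273] -/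
theorem cappedCoarseStiffnessL_of_deepStubs
    (hE : ∀ (L : ℕ) (b₀ p₀ : ℝ), 0 < b₀ → 2 < p₀ → ∃ (j₀ : ℕ) (c₀ C₀ γ₁ : ℝ), 0 < c₀ ∧ 0 < γ₁ ∧ γ₁ ≤ 1 ∧
      ∀ (F : T3Family) (γ : ℝ), F.L = L → 0 < γ → γ ≤ γ₁ → ∀ (K j : ℕ), j₀ < j → j ≤ K →
        ∫ U, Real.exp (c₀ * B10.pFun b₀ p₀ (Real.sqrt (γ * ((F.L : ℝ)⁻¹) ^ (K - j))) ^ 2 *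
            ∑ a : Plaq (F.P K) j, (if T3UnitScaleTilt.θBal F.L γ b₀ p₀ (K - j) ≤ GaugeGroup.dist1 (GaugeField.plaqHol
              (Averaging.iter (fun i => BlockAveraging.blockAvg (P := F.P K) (j := i) T3UnitLawDensityEML.ℰp) j U) a)
              then (1 : ℝ) else 0)) ∂(T3UnitScaleTilt.gibbsK F T3UnitLawDensityEML.ℰp γ K) ≤
          Real.exp (C₀ * (Fintype.card (Plaq (F.P K) j) : ℝ)))
    (hB : ∀ (L : ℕ) (b₀ p₀ : ℝ), 0 < b₀ → 2 < p₀ → ∃ (j₀ : ℕ) (γlo c₀ C₀ γ₁ : ℝ), 0 < γlo ∧ 0 < c₀ ∧ 0 < γ₁ ∧ γ₁ ≤ 1 ∧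
      ∀ (F : T3Family) (γ : ℝ), F.L = L → 0 < γ → γ ≤ γ₁ → ∀ (K j : ℕ), j ≤ K → (j₀ < j ∨ γ < γlo) →
        ∫ U, Real.exp (c₀ * (γ * ((F.L : ℝ)⁻¹) ^ (K - j))⁻¹ *
            ∑ a : Plaq (F.P K) j, (if GaugeGroup.dist1 (GaugeField.plaqHol
              (Averaging.iter (fun i => BlockAveraging.blockAvg (P := F.P K) (j := i) T3UnitLawDensityEML.ℰp) j U) a) <
                T3UnitScaleTilt.θBal F.L γ b₀ p₀ (K - j) then
              GaugeGroup.dist1 (GaugeField.plaqHol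
                (Averaging.iter (fun i => BlockAveraging.blockAvg (P := F.P K) (j := i) T3UnitLawDensityEML.ℰp) j U) a) ^ 2 else 0))
            ∂(T3UnitScaleTilt.gibbsK F T3UnitLawDensityEML.ℰp γ K) ≤
          Real.exp (C₀ * (Fintype.card (Plaq (F.P K) j) : ℝ))) :
    Summit.QuantumFields.YangMills.Theses.CoarseStiffnessTail.CappedCoarseStiffnessL :=
  cappedCoarseStiffnessL_of_subThreshold_and_uniformCount (subThresholdStiffness_of_tail hB)
    (uniformLargeFieldCount_of_pos (uniformLargeFieldCountPos_of_deep hE))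

end Compose

end Summit.QuantumFields.YangMills.Theorems.CoarseStiffnessTailDeepTailReduction

end
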